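import Mathlib
import HarnessLib
import Summits.Ventures.LatticeQCDFlow.Scaling.ProtocolDecorrelation

/-!
# ProtocolReverseChain — marginals of the REVERSE path law of a switching protocol as a forward
# evolution of the re-indexed reversed kernels, and `D(P_R ‖ P_F) = ΔF − E_R[W]`

HONEST FRAMING: exact (Metropolis-corrected) sampling algorithms for lattice gauge theory;
figures of merit are autocorrelation/cost numbers at stated couplings and volumes; no
continuum-physics claim.

Venture `LatticeQCDFlow` (cell pub-lqcd), topic `Scaling`; FANOUT row 19 (`su2-snf`, GEN-5).
OUR WORK (elementary finite sums), nothing cited as a fact.  Bookkeeping for the ESS ceiling of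
`Scaling/GeneralLayerESSCeiling.lean`, over theory-2's path-space vocabulary and
`Scaling/ProtocolDecorrelation`'s bridge to `FwdNormSqLE`
(`Scaling/StochasticFlows`: `revKernel`, `revPathLaw`, `sum_revChain_eq`, `crooks_pathwise`):

* `revIdx R J` — the backward kernels `R 0, …, R (n−1)` of a reverse chain (`R k` moves
  `ω_{k+1} ↦ ω_k`) read FORWARD from the end (`revIdx R J i = R (n−1−i)`, filler `J` beyond);
  `revIdx_zero`, `revIdx_succ`;
* **`sum_revChain_mul_apply`** — BACKWARD MARGINALISATION:
  `Σ_ω g(ω_n)·Π_i R_i(ω_{i+1}, ω_i)·f(ω_k) = Σ_x (evolveLaw (revIdx R J) g (n − k))(x)·f(x)` — the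
  time-`k` marginal of a reverse chain is the final-time weight evolved FORWARD through the
  re-indexed kernels (`sum_revChain_eq` is `f = 1`; proof peels the last coordinate,
  `Fin.snocEquiv`, and uses `ProtocolTwoTime.evolveLaw_succ_shift`);
* `revKernel_eq_of_detailedBalance` (a reversible layer is its own reversal),
  `detailedBalance_exp_of_gibbsLaw`, `revKernel_exp_eq_timeReversal` (theory-2's `e^{−S}`-reversal is
  the Literature's `timeReversal` w.r.t. the Gibbs law);
* **`chiSqContracts_timeReversal`** — a `π`-stationary layer that contracts `χ²` towards `π` with
  `ρ` has a time reversal that does so with the SAME `ρ` (via the bridge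
  `ChiSqContracts ⇔ FwdNormSqLE` of `Scaling/ProtocolDecorrelation` and Liu's PROVED norm duality
  `‖F‖ = ‖B‖`), so the ESS ceiling of the sequel is stated on the layers' own `χ²`-contraction —
  the same hypothesis as the mean-work and work-variance laws;
* **`klFin_rev_eq`** — for layers leaving each `e^{−S_{k+1}}` invariant and positive,
  `D(P_R ‖ P_F) = (F_n − F_0) − E_{P_R}[W]` (Crooks pathwise + `Σ P_R = 1`).

NOT CLAIMED: anything quantitative; this file is bookkeeping.
-/

namespace Summit.Ventures.LatticeQCDFlow.Scaling

open Finset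
open scoped Matrix
open Literature.Probability.MarkovChains (IsRowStochastic IsStationary stepLaw DetailedBalance
  IsIrreducible lambdaStar lawVariance lawMean lambdaStar_nonneg stepLaw_nonneg FwdNormSqLE
  timeReversal timeReversal_apply timeReversal_row_sum isStationary_timeReversal)
open Literature.Probability.ImportanceSampling (chiSqDiv chiSqDiv_def chiSqDiv_eq_sum_sq_div)
open Summit.Ventures.LatticeQCDFlow.Exactness
open Summit.Ventures.LatticeQCDFlow.Theory2

variable {X : Type*} [Fintype X]

/-! ## Backward (reverse-chain) marginalisation -/

/-- The backward kernels of a reverse chain `R 0, …, R (n−1)` (`R k` moves `ω_{k+1} ↦ ω_k`)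
re-indexed so that time runs forward from the END: `revIdx R J i = R (n−1−i)` for `i < n`, and the
filler kernel `J` beyond. -/
def revIdx {n : ℕ} (R : Fin n → X → X → ℝ) (J : X → X → ℝ) (i : ℕ) : X → X → ℝ :=
  if h : i < n then R ⟨n - 1 - i, by omega⟩ else J

omit [Fintype X] in
/-- `revIdx` inside the range: the re-indexed reversal. -/
theorem revIdx_of_lt {n : ℕ} (R : Fin n → X → X → ℝ) (J : X → X → ℝ) {i : ℕ} (h : i < n) :
    revIdx R J i = R ⟨n - 1 - i, by omega⟩ := by
  unfold revIdx; rw [dif_pos h]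

omit [Fintype X] in
/-- `revIdx` beyond the range: the padding kernel `J`. -/
theorem revIdx_of_le {n : ℕ} (R : Fin n → X → X → ℝ) (J : X → X → ℝ) {i : ℕ} (h : n ≤ i) :
    revIdx R J i = J := by
  unfold revIdx; rw [dif_neg (by omega)]

omit [Fintype X] in
/-- `revIdx` at index `0`. -/
theorem revIdx_zero {n : ℕ} (R : Fin (n + 1) → X → X → ℝ) (J : X → X → ℝ) :
    revIdx R J 0 = R (Fin.last n) := by
  rw [revIdx_of_lt R J (Nat.succ_pos n)]
  congr 1

omit [Fintype X] in
/-- `revIdx` at a successor index. -/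
theorem revIdx_succ {n : ℕ} (R : Fin (n + 1) → X → X → ℝ) (J : X → X → ℝ) (i : ℕ) :
    revIdx R J (i + 1) = revIdx (fun k : Fin n => R k.castSucc) J i := by
  by_cases h : i < n
  · rw [revIdx_of_lt R J (by omega), revIdx_of_lt _ J h]
    congr 1
    ext
    simp only [Fin.val_castSucc]
    omega
  · rw [revIdx_of_le R J (by omega), revIdx_of_le _ J (by omega)]

/-- **Backward marginalisation of a reverse chain.**  For backward kernels with unit row sums
(`Σ_x R k y x = 1`), a final-time weight `g` and a time `k ≤ n`:
`Σ_ω g(ω_n)·Π_i R_i(ω_{i+1}, ω_i)·f(ω_k) = Σ_x (g R_{n−1} ⋯ R_k)(x)·f(x)`, the backward marginal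
being the FORWARD-evolved law `evolveLaw (revIdx R J) g (n − k)` (any filler `J`). -/
theorem sum_revChain_mul_apply (J : X → X → ℝ) : ∀ (n : ℕ) (R : Fin n → X → X → ℝ),
    (∀ k y, ∑ x, R k y x = 1) → ∀ (g : X → ℝ) (k : Fin (n + 1)) (f : X → ℝ),
    ∑ ω : Fin (n + 1) → X, g (ω (Fin.last n))
        * (∏ i : Fin n, R i (ω i.succ) (ω i.castSucc)) * f (ω k)
      = ∑ x, evolveLaw (revIdx R J) g (n - k) x * f x
  | 0, R, _, g, k, f => by
      have hk : k = 0 := Fin.fin_one_eq_zero k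
      subst hk
      simp only [Fin.prod_univ_zero, mul_one, Nat.sub_zero, Fin.val_zero, evolveLaw_zero]
      exact Fintype.sum_equiv (Equiv.funUnique (Fin 1) X) _ _ (fun ω => rfl)
  | n + 1, R, hR, g, k, f => by
      rw [← (Fin.snocEquiv fun _ : Fin (n + 2) => X).sum_comp, Fintype.sum_prod_type]
      simp only [Fin.snocEquiv_apply, Fin.prod_univ_castSucc, Fin.snoc_last,
        Fin.snoc_castSucc, snoc_castSucc_succ', snoc_last_succ']
      have ih := sum_revChain_mul_apply J n (fun i : Fin n => R i.castSucc)
        (fun i y => hR i.castSucc y)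
      refine Fin.lastCases ?_ (fun k' => ?_) k
      · simp only [Fin.snoc_last, Fin.val_last, Nat.sub_self, evolveLaw_zero]
        refine sum_congr rfl fun x _ => ?_
        have h1 := sum_revChain_eq n (fun i : Fin n => R i.castSucc) (fun i y => hR i.castSucc y)
          (fun y => R (Fin.last n) x y)
        calc ∑ ω' : Fin (n + 1) → X, g x * ((∏ i : Fin n, R i.castSucc (ω' i.succ) (ω' i.castSucc))
              * R (Fin.last n) x (ω' (Fin.last n))) * f x
            = g x * f x * ∑ ω' : Fin (n + 1) → X, R (Fin.last n) x (ω' (Fin.last n))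
                * ∏ i : Fin n, R i.castSucc (ω' i.succ) (ω' i.castSucc) := by
              rw [mul_sum]
              exact sum_congr rfl fun ω' _ => by ring
          _ = g x * f x := by rw [h1, hR (Fin.last n) x, mul_one]
      · simp only [Fin.snoc_castSucc, Fin.val_castSucc]
        have hk' : n + 1 - (k' : ℕ) = (n - k') + 1 := by omega
        rw [hk', evolveLaw_succ_shift, revIdx_zero,
          show (fun i => revIdx R J (i + 1)) = revIdx (fun i : Fin n => R i.castSucc) J from
            funext fun i => revIdx_succ R J i,
          ← ih (stepLaw (R (Fin.last n)) g) k' f, sum_comm]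
        refine sum_congr rfl fun ω' _ => ?_
        unfold stepLaw
        rw [sum_mul, sum_mul]
        exact sum_congr rfl fun x _ => by ring

/-! ## The reverse path law of the linear protocol: mean work and relative entropy -/

omit [Fintype X] in
/-- A reversible layer is its own reversal: detailed balance with respect to `e^{−S}` gives
`revKernel e^{−S} P = P`. -/
theorem revKernel_eq_of_detailedBalance {w : X → ℝ} {P : X → X → ℝ} (hw : ∀ x, 0 < w x)
    (hDB : DetailedBalance w P) : revKernel w P = P := by
  funext y x
  unfold revKernel
  rw [hDB x y, mul_div_cancel_left₀ _ (hw y).ne']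

/-- Detailed balance is insensitive to normalising the weight: for the Gibbs law iff for the
Boltzmann weight. -/
theorem detailedBalance_exp_of_gibbsLaw [Nonempty X] {S : X → ℝ} {P : X → X → ℝ}
    (h : DetailedBalance (gibbsLaw S) P) : DetailedBalance (fun x => Real.exp (-(S x))) P := by
  intro x y
  have hZ := partitionFn_pos S
  have := h x y
  unfold gibbsLaw at this
  field_simp at this
  linarith [this]

/-- Theory-2's `revKernel` (w.r.t. any positive weight proportional to `π`) is the Literature's
`timeReversal` w.r.t. `π`; in particular the `e^{−S}`-reversal is the `gibbsLaw S`-time-reversal. -/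
theorem revKernel_exp_eq_timeReversal [Nonempty X] (S : X → ℝ) (K : X → X → ℝ) :
    revKernel (fun x => Real.exp (-(S x))) K = timeReversal (gibbsLaw S) K := by
  funext y x
  rw [timeReversal_apply]
  unfold revKernel gibbsLaw
  have hZ := (partitionFn_pos S).ne'
  have hy := (Real.exp_pos (-(S y))).ne'
  field_simp

/-- **A layer that contracts `χ²` towards `π` has a REVERSAL that does so with the same
coefficient** (`π > 0` of unit mass, `π`-stationary `K` with unit row sums, `ρ ≥ 0`):
`ChiSqContracts K π ρ ⇒ ChiSqContracts (timeReversal π K) π ρ`.  Route: the law-side contraction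
of `K` is the forward-operator bound of `K̂` (`fwdNormSqLE_timeReversal_of_chiSqContracts`), and a
forward-operator bound of a stationary layer is a law-side contraction of it
(`chiSqContracts_of_fwdNormSqLE`, Liu's norm duality) — applied to `K̂`, which is stationary with
unit row sums. -/
theorem chiSqContracts_timeReversal {K : X → X → ℝ} {π : X → ℝ} {ρ : ℝ}
    (hπ : ∀ x, 0 < π x) (hπ1 : ∑ x, π x = 1) (hK1 : ∀ x, ∑ y, K x y = 1)
    (hst : IsStationary π K) (hρ : 0 ≤ ρ) (hC : ChiSqContracts K π ρ) :
    ChiSqContracts (timeReversal π K) π ρ := by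
  have hF := fwdNormSqLE_timeReversal_of_chiSqContracts hπ hπ1 hst hC
  have h := chiSqContracts_of_fwdNormSqLE hπ hπ1 (timeReversal_row_sum hπ hst)
    (isStationary_timeReversal hπ hK1) (sq_nonneg ρ) hF
  rwa [Real.sqrt_sq hρ] at h

/-- **`D(P_R ‖ P_F) = ΔF − E_R[W]`** (Crooks pathwise): the reverse relative entropy of the
protocol is the free-energy difference minus the mean work UNDER THE REVERSE PATH LAW. -/
theorem klFin_rev_eq [Nonempty X] {n : ℕ} (S : Fin (n + 1) → X → ℝ) (P : Fin n → X → X → ℝ)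
    (hst : ∀ k : Fin n, IsStationary (fun x => Real.exp (-(S k.succ x))) (P k))
    (hPpos : ∀ k x y, 0 < P k x y) :
    klFin (revPathLaw S P) (pathLaw (gibbsLaw (S 0)) P)
      = (freeEnergy (S (Fin.last n)) - freeEnergy (S 0))
        - ∑ ω, revPathLaw S P ω * work S ω := by
  have hZ0 := partitionFn_pos (S 0)
  have hZn := partitionFn_pos (S (Fin.last n))
  have hratio : ∀ ω, revPathLaw S P ω / pathLaw (gibbsLaw (S 0)) P ω
      = partitionFn (S 0) / partitionFn (S (Fin.last n)) * Real.exp (-(work S ω)) := by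
    intro ω
    have hc := crooks_pathwise S P ω
    have hF : 0 < pathLaw (gibbsLaw (S 0)) P ω := pathLaw_pos (gibbsLaw_pos (S 0)) hPpos ω
    rw [div_eq_iff hF.ne']
    have : revPathLaw S P ω = partitionFn (S 0) / partitionFn (S (Fin.last n))
        * (pathLaw (gibbsLaw (S 0)) P ω * Real.exp (-(work S ω))) := by
      rw [hc]; field_simp
    rw [this]; ring
  unfold klFin
  have hlog : ∀ ω, Real.log (revPathLaw S P ω / pathLaw (gibbsLaw (S 0)) P ω)
      = (freeEnergy (S (Fin.last n)) - freeEnergy (S 0)) - work S ω := by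
    intro ω
    rw [hratio ω, Real.log_mul (div_pos hZ0 hZn).ne' (Real.exp_pos _).ne', Real.log_exp,
      Real.log_div hZ0.ne' hZn.ne']
    unfold freeEnergy
    ring
  simp_rw [hlog, mul_sub, sum_sub_distrib, ← sum_mul, sum_revPathLaw S P hst, one_mul]


end Summit.Ventures.LatticeQCDFlow.Scaling
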